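import Summits.Ventures.Crystal3D.Bulk.TwelveNeighbourGap
import Summits.Ventures.Crystal3D.Bulk.IntruderWitness
import HarnessLib

/-!
# The four typed forms of GAP are equivalent

HONEST FRAMING. Part of the venture `Summits/Ventures/Crystal3D` (cell `pub-crystal3d`, phase 2,
`PLAN.md` R41; seat typer-bulk-2, answering the seat theory-1's ask of 2026-08-22T18:10Z). The
cell's census target GAP ("a twelve-kissed ball admits no further centre closer than the gap")
has four formal referents in the tree:

* `TwelveNeighbourGap ρ` (seat typer-bulk, `Bulk/TwelveNeighbourGap.lean`): finite labelled
  packings `x : Fin N → ℝ³` of unit-DIAMETER balls, `coordination x i = 12 ⇒ dist = 1 ∨ ρ ≤ dist`;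
* `GapTupleDiam ρ` (`Bulk/GapReduction.lean`): fourteen centres, diameter-one units;
* `GapTuple δ` (`Bulk/GapReduction.lean`): fourteen centres, Hales's radius-one units
  (`BoroczkySzabo2015_thm3 ↔ GapTuple 2.51838585`);
* `KissingGap δ` (`Bulk/GapReduction.lean`): point sets `V ⊆ ℝ³` (`IsUnitBallPacking`,
  `kissingShell`), radius-one units.

This file PROVES `TwelveNeighbourGap ρ ↔ GapTupleDiam ρ ↔ GapTuple (2ρ) ↔ KissingGap (2ρ)`.
The only non-bookkeeping input is the kissing number (`coordination_le_twelve`, a theorem of the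
tree): in the fourteen-ball forms the fourteenth ball cannot be a thirteenth contact. Consequence:
a census certificate for ANY of the four discharges all of them, and the kernel negative
`not_gapTupleDiam_of_lt` (`Bulk/IntruderWitness.lean`) transfers: `¬ TwelveNeighbourGap ρ` for
every `ρ > 7√3/9`. Nothing is claimed about the true constant.
-/

noncomputable section

open scoped BigOperators
open Finset

namespace Summit.Ventures.Crystal3D

open Literature.Geometry.DiscreteGeometry

/-! ## Fourteen balls ↔ finite packings (diameter-one units) -/

/-- **A fourteen-tuple of centres pairwise `≥ 1` apart is a unit packing of fourteen balls, and
its first ball has exactly the twelve prescribed contacts**: the fourteenth ball does not touch it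
(kissing number twelve). -/
theorem coordination_eq_twelve_of_tuple {c : Fin 14 → EuclideanSpace ℝ (Fin 3)}
    (hpack : ∀ i j : Fin 14, i ≠ j → (1 : ℝ) ≤ dist (c i) (c j))
    (htouch : ∀ i : Fin 14, i ≠ 0 → i ≠ 13 → dist (c i) (c 0) = 1) :
    coordination c 0 = 12 ∧ dist (c 0) (c 13) ≠ 1 := by
  have hx : IsUnitPacking c := fun a b hab => hpack a b hab
  have hsub : (univ.filter fun k : Fin 14 => k ≠ 0 ∧ k ≠ 13) ⊆ contactNeighbors c 0 := by
    intro k hk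
    rw [mem_filter] at hk
    exact (mem_contactNeighbors c).2 ⟨hk.2.1, by rw [dist_comm]; exact htouch k hk.2.1 hk.2.2⟩
  have hcard12 : (univ.filter fun k : Fin 14 => k ≠ 0 ∧ k ≠ 13).card = 12 := by decide
  have hle : (contactNeighbors c 0).card ≤ 12 := coordination_le_twelve hx 0
  have hge : 12 ≤ (contactNeighbors c 0).card := hcard12 ▸ card_le_card hsub
  refine ⟨le_antisymm hle hge, fun hd => ?_⟩
  have hsub' : insert (13 : Fin 14) (univ.filter fun k : Fin 14 => k ≠ 0 ∧ k ≠ 13) ⊆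
      contactNeighbors c 0 := by
    intro k hk
    rcases mem_insert.1 hk with rfl | hk
    · exact (mem_contactNeighbors c).2 ⟨by decide, hd⟩
    · exact hsub hk
  have h13 := card_le_card hsub'
  rw [card_insert_of_notMem (by simp), hcard12] at h13
  omega

/-- **`TwelveNeighbourGap ρ → GapTupleDiam ρ`.** -/
theorem gapTupleDiam_of_twelveNeighbourGap {ρ : ℝ} (h : TwelveNeighbourGap ρ) :
    GapTupleDiam ρ := by
  intro c hpack htouch
  obtain ⟨h12, h13⟩ := coordination_eq_twelve_of_tuple hpack htouch
  rcases h 14 c (fun a b hab => hpack a b hab) 0 13 h12 (by decide) with hd | hd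
  · exact absurd hd h13
  · exact hd

/-- **`GapTupleDiam ρ → TwelveNeighbourGap ρ`**: restrict a packing to the fourteen relevant
balls (the centre, its twelve contact neighbours enumerated by `Finset.orderEmbOfFin`, and the
other ball). -/
theorem twelveNeighbourGap_of_gapTupleDiam {ρ : ℝ} (h : GapTupleDiam ρ) :
    TwelveNeighbourGap ρ := by
  intro N x hx i j hi hj
  by_cases h1 : dist (x i) (x j) = 1
  · exact Or.inl h1
  right
  have hcard : (contactNeighbors x i).card = 12 := hi
  let e : Fin 12 ↪o Fin N := (contactNeighbors x i).orderEmbOfFin hcard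
  have he : ∀ k, e k ∈ contactNeighbors x i := fun k => orderEmbOfFin_mem _ hcard k
  have hei : ∀ k, e k ≠ i := fun k hk => not_mem_contactNeighbors_self x i (hk ▸ he k)
  have hej : ∀ k, e k ≠ j := fun k hk =>
    h1 (((mem_contactNeighbors x).1 (hk ▸ he k)).2)
  -- the index map `Fin 14 → Fin N`
  let g : Fin 14 → Fin N := fun k => e ⟨((k : ℕ) - 1) % 12, Nat.mod_lt _ (by norm_num)⟩
  let ι : Fin 14 → Fin N := fun k => if k = 0 then i else if k = 13 then j else g k
  have hι0 : ι 0 = i := by simp [ι]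
  have hι13 : ι 13 = j := by simp [ι]
  have hιmid : ∀ k : Fin 14, k ≠ 0 → k ≠ 13 → ι k = g k := fun k hk0 hk13 => by
    simp [ι, hk0, hk13]
  have hginj : ∀ a b : Fin 14, a ≠ 0 → a ≠ 13 → b ≠ 0 → b ≠ 13 → g a = g b → a = b := by
    intro a b ha0 ha13 hb0 hb13 hab
    have h' := congrArg Fin.val (e.injective hab)
    simp only at h'
    have ha0' : (a : ℕ) ≠ 0 := fun h => ha0 (Fin.ext h)
    have ha13' : (a : ℕ) ≠ 13 := fun h => ha13 (Fin.ext h)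
    have hb0' : (b : ℕ) ≠ 0 := fun h => hb0 (Fin.ext h)
    have hb13' : (b : ℕ) ≠ 13 := fun h => hb13 (Fin.ext h)
    have ha := a.isLt
    have hb := b.isLt
    exact Fin.ext (by omega)
  have hιinj : ∀ a b : Fin 14, a ≠ b → ι a ≠ ι b := by
    intro a b hab hι
    by_cases ha0 : a = 0
    · subst ha0
      by_cases hb13 : b = 13
      · subst hb13; rw [hι0, hι13] at hι; exact hj hι.symm
      rw [hι0, hιmid b (Ne.symm hab) hb13] at hι
      exact hei _ hι.symm
    by_cases ha13 : a = 13
    · subst ha13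
      by_cases hb0 : b = 0
      · subst hb0; rw [hι0, hι13] at hι; exact hj hι
      rw [hι13, hιmid b hb0 (Ne.symm hab)] at hι
      exact hej _ hι.symm
    by_cases hb0 : b = 0
    · subst hb0; rw [hι0, hιmid a ha0 ha13] at hι
      exact hei _ hι
    by_cases hb13 : b = 13
    · subst hb13; rw [hι13, hιmid a ha0 ha13] at hι
      exact hej _ hι
    rw [hιmid a ha0 ha13, hιmid b hb0 hb13] at hι
    exact hab (hginj a b ha0 ha13 hb0 hb13 hι)
  -- the fourteen balls
  have hpack : ∀ a b : Fin 14, a ≠ b → (1 : ℝ) ≤ dist (x (ι a)) (x (ι b)) := fun a b hab =>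
    hx (hιinj a b hab)
  have htouch : ∀ a : Fin 14, a ≠ 0 → a ≠ 13 → dist (x (ι a)) (x (ι 0)) = 1 := fun a ha0 ha13 => by
    rw [hιmid a ha0 ha13, hι0, dist_comm]
    exact ((mem_contactNeighbors x).1 (he _)).2
  have := h (fun k => x (ι k)) hpack htouch
  rwa [hι0, hι13] at this

/-- **`TwelveNeighbourGap ρ ↔ GapTupleDiam ρ`** (theory-1's ask (i)): the census may certify either
form. -/
theorem twelveNeighbourGap_iff_gapTupleDiam (ρ : ℝ) : TwelveNeighbourGap ρ ↔ GapTupleDiam ρ :=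
  ⟨gapTupleDiam_of_twelveNeighbourGap, twelveNeighbourGap_of_gapTupleDiam⟩

/-! ## Radius-one forms -/

/-- **`KissingGap (2ρ) → TwelveNeighbourGap ρ`**: apply the point-set form to the doubled packing
`{2 xₖ}` at the centre `2 xᵢ`. -/
theorem twelveNeighbourGap_of_kissingGap {ρ : ℝ} (h : KissingGap (2 * ρ)) :
    TwelveNeighbourGap ρ := by
  intro N x hx i j hi hj
  have hV := isUnitBallPacking_range_two_smul hx
  have h12 : (kissingShell (Set.range fun k => (2 : ℝ) • x k) ((2 : ℝ) • x i)).ncard = 12 := by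
    rw [ncard_kissingShell_range_two_smul hx, hi]
  rcases h _ hV ((2 : ℝ) • x i) ⟨i, rfl⟩ h12 ((2 : ℝ) • x j) ⟨j, rfl⟩ with h' | h' | h'
  · exact absurd (hx.injective (smul_right_injective _ (two_ne_zero (α := ℝ)) h')).symm hj
  · left
    rw [dist_two_smul] at h'
    linarith
  · right
    rw [dist_two_smul] at h'
    linarith

/-- **`TwelveNeighbourGap ρ → KissingGap (2ρ)`** (through the fourteen-ball forms). -/
theorem kissingGap_of_twelveNeighbourGap {ρ : ℝ} (h : TwelveNeighbourGap ρ) :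
    KissingGap (2 * ρ) :=
  kissingGap_of_gapTuple ((gapTupleDiam_iff ρ).1 (gapTupleDiam_of_twelveNeighbourGap h))

/-- **`KissingGap (2ρ) ↔ TwelveNeighbourGap ρ`.** -/
theorem kissingGap_iff_twelveNeighbourGap (ρ : ℝ) : KissingGap (2 * ρ) ↔ TwelveNeighbourGap ρ :=
  ⟨twelveNeighbourGap_of_kissingGap, kissingGap_of_twelveNeighbourGap⟩

/-- **`GapTuple (2ρ) ↔ TwelveNeighbourGap ρ`.** -/
theorem gapTuple_iff_twelveNeighbourGap (ρ : ℝ) : GapTuple (2 * ρ) ↔ TwelveNeighbourGap ρ :=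
  (gapTupleDiam_iff ρ).symm.trans (twelveNeighbourGap_iff_gapTupleDiam ρ).symm

/-- **`GapTuple δ ↔ KissingGap δ`**: the fourteen-ball and point-set radius-one forms agree. -/
theorem gapTuple_iff_kissingGap (δ : ℝ) : GapTuple δ ↔ KissingGap δ := by
  have e : δ = 2 * (δ / 2) := by ring
  rw [e]
  exact (gapTuple_iff_twelveNeighbourGap (δ / 2)).trans
    (kissingGap_iff_twelveNeighbourGap (δ / 2)).symm

/-! ## Consequences -/

/-- Böröczky–Szabó's Theorem 3 IS `TwelveNeighbourGap (2.51838585 / 2)`. -/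
theorem boroczkySzabo2015_thm3_iff_twelveNeighbourGap :
    BoroczkySzabo2015_thm3 ↔ TwelveNeighbourGap (2.51838585 / 2) := by
  rw [boroczkySzabo2015_thm3_iff, ← gapTuple_iff_twelveNeighbourGap]
  norm_num

/-- **The intruder witness in typer-bulk's form**: `TwelveNeighbourGap ρ` is false for every
`ρ > 7√3/9 = 1.3471…`. -/
theorem not_twelveNeighbourGap_of_lt {ρ : ℝ} (h : 7 * Real.sqrt 3 / 9 < ρ) :
    ¬ TwelveNeighbourGap ρ := fun hg =>
  not_gapTupleDiam_of_lt h (gapTupleDiam_of_twelveNeighbourGap hg)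

/-- In particular `¬ TwelveNeighbourGap 1.3472`, while `TwelveNeighbourGap 1.26` holds under
`flyspeck_L12` (`twelveNeighbourGap_of_L12`). -/
theorem not_twelveNeighbourGap_13472 : ¬ TwelveNeighbourGap 1.3472 :=
  not_twelveNeighbourGap_of_lt Intruder.seven_sqrt_three_div_nine_bounds.2

end Summit.Ventures.Crystal3D

end
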